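import Mathlib
import HarnessLib

/-!
# Calibration truths of the fitness scorers: the `exact` column of the τ_int calibration set

HONEST FRAMING: exact (Metropolis-corrected) sampling algorithms for lattice gauge theory;
figures of merit are autocorrelation/cost numbers at stated couplings and volumes; no
continuum-physics claim.

Venture `LatticeQCDFlow` (cell pub-lqcd), sub-topic `Scoring`; FANOUT row 11 (`eng-scorerA`,
fitness scorer A: Γ-method τ_int, ESS, Eff = Var·2τ_int·cost, calibration set).  NEW WORK of the
cell (elementary series evaluations), not a published result; nothing is cited as a fact.

## Content

Both frozen scorers (A 0.1.2, B 0.1.8) are calibrated against synthetic series whose integrated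
autocorrelation time is known in closed form (FITNESS.md §3 as corrected by B3; scorer A
`calibration/generators.py`, scorer B `calib`).  With the normalised autocorrelation function
`ρ : ℕ → ℝ` (`ρ 0 = 1`) the integrated autocorrelation time is

  `τ_int = 1/2 + ∑_{t ≥ 1} ρ t`                                   (`tauInt`)

(Madras–Sokal / Wolff convention, the one both scorers and FITNESS §1 use: the variance of a mean
of `N` correlated samples is `2 τ_int σ² / N`, so `n_eff = N / (2 τ_int)` in chain mode).  This
file evaluates `tauInt` for the three calibration families and records the table's constants as
kernel-checked rationals:

* `tauInt_geometric` — `ρ t = r ^ t`, `|r| < 1` ⟹ `τ_int = (1 + r) / (2 (1 − r))`; this is set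
  **C-1** (AR(1) `x_t = r x_{t−1} + √(1−r²) ε_t`, whose normalised ACF is `r ^ t`):
  `r = 1/2, 9/10, 99/100` give `3/2, 19/2, 199/2` (`tauInt_C1_*`);
* `tauInt_mixture` — `ρ t = a r^t + b s^t` ⟹ `τ_int = 1/2 + a r/(1−r) + b s/(1−s)`; set **C-1b**
  (two-scale windowing trap `x = √(10/11)·AR1(1/2) + √(1/11)·AR1(999/1000)`, independent unit-variance
  components, so `a = 10/11`, `b = 1/11`) gives `2029/22 = 92.2272…` (`tauInt_C1b`), the constant
  `TAU_C1B = 0.5 + (10/11)·1 + (1/11)·999` of `run_calibration.py`;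
* `tauInt_telegraph` — `ρ t = (1 − 2p)^t`, `0 < p < 1` ⟹ `τ_int = (1 − p)/(2p)`; set **C-1c**
  (symmetric telegraph / two-state Markov sector signal with flip probability `p` per step) gives
  `999/2 = 499.5` at `p = 1/1000` (`tauInt_C1c`);
* `nEffChain_gt_iff` — in chain mode `n_eff = N/(2 τ_int)` exceeds the sample count `N` iff
  `τ_int < 1/2` (an anticorrelated or mis-windowed series), the arithmetic behind the board's
  chain-mode `W-NEFF-GT-N` wording (latflow.board 0.1.11 H2) as opposed to the reweight-mode cap
  `n_eff_used = min(n_eff, N, Kish ESS)` (lead RA-28; `Exactness.essHat_le_one` is the Kish half).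

Dictionary (standard stationary-process facts, NOT formalised here): the normalised ACF of the
stationary AR(1) process with coefficient `r` is `r^|t|`; of an independent sum `Σ cₖ Xₖ` of
unit-variance processes it is the `cₖ²`-weighted mixture of theirs; of the symmetric two-state
chain with flip probability `p` it is `(1 − 2p)^|t|`.  What is proved below is exactly the series
arithmetic turning those ACFs into the numbers the calibration reports compare against.
-/

namespace Summit.Ventures.LatticeQCDFlow.Scoring

open scoped BigOperators

/-- Integrated autocorrelation time of a normalised autocorrelation function `ρ` (`ρ 0 = 1`):
`τ_int = 1/2 + ∑_{t ≥ 1} ρ t` (Madras–Sokal / Wolff convention; `∑'` is `0` on a non-summable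
tail, Lean's convention — every use below comes with a `HasSum`). -/
noncomputable def tauInt (ρ : ℕ → ℝ) : ℝ :=
  1 / 2 + ∑' t, ρ (t + 1)

/-- The chain-mode effective sample count `n_eff = N / (2 τ_int)` (FITNESS §1 / FITNESS-A §A2). -/
noncomputable def nEffChain (N τ : ℝ) : ℝ :=
  N / (2 * τ)

/-- The shifted geometric series: `∑_{t ≥ 0} r^(t+1) = r / (1 − r)` for `|r| < 1`. -/
theorem hasSum_geometric_succ {r : ℝ} (hr : |r| < 1) :
    HasSum (fun t : ℕ => r ^ (t + 1)) (r / (1 - r)) := by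
  have h := (hasSum_geometric_of_abs_lt_one hr).mul_left r
  simp only [← pow_succ'] at h
  simpa [div_eq_mul_inv] using h

/-- **C-1 (geometric / AR(1) ACF).** `ρ t = r^t` with `|r| < 1` has
`τ_int = (1 + r) / (2 (1 − r))`. -/
theorem tauInt_geometric {r : ℝ} (hr : |r| < 1) :
    tauInt (fun t => r ^ t) = (1 + r) / (2 * (1 - r)) := by
  have h1 : (1 : ℝ) - r ≠ 0 := by
    have := (abs_lt.mp hr).2
    exact ne_of_gt (by linarith)
  simp only [tauInt, (hasSum_geometric_succ hr).tsum_eq]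
  field_simp
  ring

/-- C-1, `ρ = 1/2`: `τ_int = 3/2`. -/
theorem tauInt_C1_half : tauInt (fun t => (1 / 2 : ℝ) ^ t) = 3 / 2 := by
  rw [tauInt_geometric (abs_lt.mpr ⟨by norm_num, by norm_num⟩)]
  norm_num

/-- C-1, `ρ = 9/10`: `τ_int = 19/2`. -/
theorem tauInt_C1_p9 : tauInt (fun t => (9 / 10 : ℝ) ^ t) = 19 / 2 := by
  rw [tauInt_geometric (abs_lt.mpr ⟨by norm_num, by norm_num⟩)]
  norm_num

/-- C-1, `ρ = 99/100`: `τ_int = 199/2`. -/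
theorem tauInt_C1_p99 : tauInt (fun t => (99 / 100 : ℝ) ^ t) = 199 / 2 := by
  rw [tauInt_geometric (abs_lt.mpr ⟨by norm_num, by norm_num⟩)]
  norm_num

/-- **C-1b (two-scale mixture).** `ρ t = a r^t + b s^t` with `|r|, |s| < 1` has
`τ_int = 1/2 + a r/(1 − r) + b s/(1 − s)` — the long scale enters with its full weight however
small `b` is (the windowing trap). -/
theorem tauInt_mixture (a b : ℝ) {r s : ℝ} (hr : |r| < 1) (hs : |s| < 1) :
    tauInt (fun t => a * r ^ t + b * s ^ t) = 1 / 2 + a * (r / (1 - r)) + b * (s / (1 - s)) := by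
  have h := ((hasSum_geometric_succ hr).mul_left a).add ((hasSum_geometric_succ hs).mul_left b)
  simp only [tauInt, h.tsum_eq]
  ring

/-- C-1b of record: `a = 10/11, r = 1/2, b = 1/11, s = 999/1000` ⟹ `τ_int = 2029/22 = 92.2272…`
(`TAU_C1B` of scorer A's `run_calibration.py`; scorer B's `calib` prints the same constant). -/
theorem tauInt_C1b :
    tauInt (fun t => (10 / 11 : ℝ) * (1 / 2 : ℝ) ^ t + (1 / 11 : ℝ) * (999 / 1000 : ℝ) ^ t)
      = 2029 / 22 := by
  rw [tauInt_mixture (10 / 11) (1 / 11) (abs_lt.mpr ⟨by norm_num, by norm_num⟩)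
    (abs_lt.mpr ⟨by norm_num, by norm_num⟩)]
  norm_num

/-- **C-1c (symmetric telegraph).** `ρ t = (1 − 2p)^t` with `0 < p < 1` has
`τ_int = (1 − p) / (2 p)`. -/
theorem tauInt_telegraph {p : ℝ} (hp : 0 < p) (hp1 : p < 1) :
    tauInt (fun t => (1 - 2 * p) ^ t) = (1 - p) / (2 * p) := by
  have habs : |1 - 2 * p| < 1 := abs_lt.mpr ⟨by linarith, by linarith⟩
  rw [tauInt_geometric habs]
  have hp0 : p ≠ 0 := ne_of_gt hp
  field_simp
  ring

/-- C-1c of record: `p = 1/1000` ⟹ `τ_int = 999/2 = 499.5` (mean dwell `1/p = 1000`). -/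
theorem tauInt_C1c : tauInt (fun t => (1 - 2 * (1 / 1000 : ℝ)) ^ t) = 999 / 2 := by
  rw [tauInt_telegraph (by norm_num) (by norm_num)]
  norm_num

/-- Chain mode: `n_eff = N/(2τ) > N` iff `τ < 1/2` (for `N, τ > 0`) — an effective count above
the sample count says only that the series is anticorrelated (or the Γ-window mis-set), which
is what the board's chain-mode `W-NEFF-GT-N` says; it is not the reweight-mode weight collapse. -/
theorem nEffChain_gt_iff {N τ : ℝ} (hN : 0 < N) (hτ : 0 < τ) :
    N < nEffChain N τ ↔ τ < 1 / 2 := by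
  unfold nEffChain
  rw [lt_div_iff₀ (by positivity)]
  constructor
  · intro h; nlinarith
  · intro h; nlinarith

/-- Chain mode: `τ ≥ 1/2` ⟹ `n_eff ≤ N` (no effective count above the sample count). -/
theorem nEffChain_le_of_half_le {N τ : ℝ} (hN : 0 ≤ N) (hτ : 1 / 2 ≤ τ) :
    nEffChain N τ ≤ N := by
  unfold nEffChain
  rw [div_le_iff₀ (by positivity)]
  nlinarith


/-! ## Window truncation (appended 2026-08-21, row 11 GEN-5)

The Γ-method does not sum the ACF to infinity: it stops at a window `W` (Madras–Sokal; Wolff 2004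
chooses `W` automatically by balancing this truncation bias against the statistical error of the
windowed sum).  On the geometric calibration family the bias is available in closed form, which is
what makes set C-1 a calibration of the WINDOW and not only of the arithmetic: the windowed value
`τ_W = 1/2 + Σ_{t=1}^{W} r^t` misses exactly `r^(W+1)/(1 − r)`.  E.g. `r = 99/100`: the full value is
`199/2`; a window `W = 600 ≈ 6 τ` leaves `0.99^601 · 100 ≈ 0.24` (0.24 %), inside the 2 % acceptance
band but visible at `N = 10⁷` statistics — the systematic the calibration reports as 'bias-corrected'. -/

/-- The WINDOWED integrated autocorrelation time `τ_W = 1/2 + Σ_{t=1}^{W} ρ t` (the Γ-method's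
truncated sum; `W = 0` gives `1/2`). -/
noncomputable def tauIntWindow (ρ : ℕ → ℝ) (W : ℕ) : ℝ :=
  1 / 2 + ∑ t ∈ Finset.range W, ρ (t + 1)

/-- Windowed geometric sum: `τ_W(t ↦ r^t) = 1/2 + r (1 − r^W)/(1 − r)` for `r ≠ 1`. -/
theorem tauIntWindow_geometric {r : ℝ} (hr : r ≠ 1) (W : ℕ) :
    tauIntWindow (fun t => r ^ t) W = 1 / 2 + r * (1 - r ^ W) / (1 - r) := by
  have h1 : (1 : ℝ) - r ≠ 0 := sub_ne_zero.mpr (Ne.symm hr)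
  have hg : ∑ t ∈ Finset.range W, r ^ (t + 1) = r * ∑ t ∈ Finset.range W, r ^ t := by
    rw [Finset.mul_sum]
    refine Finset.sum_congr rfl fun t _ => ?_
    ring
  simp only [tauIntWindow, hg, geom_sum_eq hr W]
  have h2 : r - 1 ≠ 0 := sub_ne_zero.mpr hr
  field_simp
  ring

/-- **Truncation bias on the calibration family.** For `|r| < 1` the window `W` misses exactly
`τ_int − τ_W = r^(W+1) / (1 − r)` of the geometric ACF's integrated autocorrelation time. -/
theorem tauInt_sub_tauIntWindow_geometric {r : ℝ} (hr : |r| < 1) (W : ℕ) :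
    tauInt (fun t => r ^ t) - tauIntWindow (fun t => r ^ t) W = r ^ (W + 1) / (1 - r) := by
  have hr1 : r ≠ 1 := by
    have := (abs_lt.mp hr).2
    exact ne_of_lt this
  have h1 : (1 : ℝ) - r ≠ 0 := sub_ne_zero.mpr (Ne.symm hr1)
  rw [tauInt_geometric hr, tauIntWindow_geometric hr1 W]
  field_simp
  ring

/-- The truncation bias is strictly positive for a positively correlated series (`0 < r < 1`):
a finite window always UNDER-estimates `τ_int` on set C-1, by the amount above. -/
theorem tauIntWindow_lt_tauInt_geometric {r : ℝ} (hr0 : 0 < r) (hr1 : r < 1) (W : ℕ) :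
    tauIntWindow (fun t => r ^ t) W < tauInt (fun t => r ^ t) := by
  have habs : |r| < 1 := abs_lt.mpr ⟨by linarith, hr1⟩
  have h := tauInt_sub_tauIntWindow_geometric habs W
  have hpos : 0 < r ^ (W + 1) / (1 - r) := div_pos (pow_pos hr0 _) (by linarith)
  linarith

/-! ## The Γ-method error budget at a window `W = c·τ` (appended 2026-08-21, row 11 GEN-7)

Wolff's leading-order statistical error of the windowed estimator (CPC 156 (2004) §3.3 — the
number scorer A prints as `dtau_int`, gamma.py l.187) is `δτ = 2 τ √((W + ½ − τ)/N)`.  At a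
self-consistent window `W = c·τ` (Madras–Sokal's constant `c`; Wolff's automatic window sat at
`W_opt/τ̂ = 5.7–5.9` on row 16's F1 E2 file) the squared RELATIVE error is exactly

  `(δτ/τ)² = (4 (c − 1) τ + 2) / N`                                   (`wolffDTau_div_sq`)

so a relative error budget `ε` needs `N ≥ (4 (c − 1) τ + 2) / ε²` samples
(`wolffRelErrSq_le_iff`).  At `c = 6` this is the arithmetic behind row 11's advice to the
baseline rows (HOME/eng-scorera/READ-windowing-row16-E2.md): the FITNESS-A A2 / `V5:short`
floor `N = 400 τ` only guarantees `(δτ/τ)² = 1/20 + 1/(200 τ) ≥ 1/20`, i.e. `δτ/τ > 22.3 %`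
(`wolffRelErrSq_floor400`, `wolffRelErr_floor400_gt`), `N = 1000 τ` gives `≥ 1/50` (14.1 %) and
`N = 2000 τ` gives `≥ 1/100` (10 %) (`wolffRelErrSq_at`).  The floor is a floor against nonsense,
not an accuracy promise — and the formula contains neither the truncation bias
(`tauInt_sub_tauIntWindow_geometric` above) nor the coupling between `W_opt` and `τ̂`.
-/

/-- Wolff's leading-order error of the windowed `τ̂_int` at window `W` from `N` samples
(CPC 156 (2004) §3.3; scorer A's `dtau_int`): `δτ = 2 τ √((W + ½ − τ) / N)`. -/
noncomputable def wolffDTau (τ W N : ℝ) : ℝ :=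
  2 * τ * Real.sqrt ((W + 1 / 2 - τ) / N)

/-- **Squared relative error at a self-consistent window `W = c τ`**:
`(δτ/τ)² = (4 (c − 1) τ + 2) / N`. -/
theorem wolffDTau_div_sq {τ c N : ℝ} (hτ : 0 < τ) (hN : 0 < N) (hc : 1 ≤ c) :
    (wolffDTau τ (c * τ) N / τ) ^ 2 = (4 * (c - 1) * τ + 2) / N := by
  unfold wolffDTau
  have harg : 0 ≤ (c * τ + 1 / 2 - τ) / N := div_nonneg (by nlinarith) hN.le
  have hrw : 2 * τ * Real.sqrt ((c * τ + 1 / 2 - τ) / N) / τ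
      = 2 * Real.sqrt ((c * τ + 1 / 2 - τ) / N) := by
    field_simp
  rw [hrw, mul_pow, Real.sq_sqrt harg]
  field_simp
  ring

/-- The budget form: `(δτ/τ)² ≤ ε²` iff `N ≥ (4 (c − 1) τ + 2) / ε²`. -/
theorem wolffRelErrSq_le_iff {τ c N ε : ℝ} (hτ : 0 < τ) (hN : 0 < N) (hc : 1 ≤ c) (hε : 0 < ε) :
    (wolffDTau τ (c * τ) N / τ) ^ 2 ≤ ε ^ 2 ↔ (4 * (c - 1) * τ + 2) / ε ^ 2 ≤ N := by
  rw [wolffDTau_div_sq hτ hN hc, div_le_iff₀ hN, div_le_iff₀ (pow_pos hε 2), mul_comm N]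

/-- At `c = 6` and `N = m·τ` samples: `(δτ/τ)² = 20/m + 2/(m τ)` — e.g. `m = 400, 1000, 2000`
give `1/20 + …`, `1/50 + …`, `1/100 + …`. -/
theorem wolffRelErrSq_at {τ m : ℝ} (hτ : 0 < τ) (hm : 0 < m) :
    (wolffDTau τ (6 * τ) (m * τ) / τ) ^ 2 = 20 / m + 2 / (m * τ) := by
  rw [wolffDTau_div_sq hτ (mul_pos hm hτ) (by norm_num)]
  field_simp
  ring

/-- **The `V5:short` floor is not an accuracy promise**: at `N = 400 τ` (FITNESS-A A2) and
`c = 6`, `(δτ/τ)² = 1/20 + 1/(200 τ) ≥ 1/20`. -/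
theorem wolffRelErrSq_floor400 {τ : ℝ} (hτ : 0 < τ) :
    (wolffDTau τ (6 * τ) (400 * τ) / τ) ^ 2 = 1 / 20 + 1 / (200 * τ) ∧
      1 / 20 ≤ (wolffDTau τ (6 * τ) (400 * τ) / τ) ^ 2 := by
  have h := wolffRelErrSq_at hτ (by norm_num : (0 : ℝ) < 400)
  have hpos : 0 < 1 / (200 * τ) := by positivity
  refine ⟨by rw [h]; ring, ?_⟩
  rw [h]
  have : (20 : ℝ) / 400 + 2 / (400 * τ) = 1 / 20 + 1 / (200 * τ) := by ring
  rw [this]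
  linarith

/-- … i.e. the relative error at the floor exceeds `22.3 %` (since `0.223² < 1/20`). -/
theorem wolffRelErr_floor400_gt {τ : ℝ} (hτ : 0 < τ) :
    223 / 1000 < wolffDTau τ (6 * τ) (400 * τ) / τ := by
  have hsq := (wolffRelErrSq_floor400 hτ).2
  have hnonneg : 0 ≤ wolffDTau τ (6 * τ) (400 * τ) / τ := by
    unfold wolffDTau
    have : 0 ≤ Real.sqrt ((6 * τ + 1 / 2 - τ) / (400 * τ)) := Real.sqrt_nonneg _
    positivity
  nlinarith [hsq, hnonneg]

end Summit.Ventures.LatticeQCDFlow.Scoring
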